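import Summits.CriticalPhenomena.Ising3DConformalLimit.Theses.LocalisationClock

/-!
# Birth skeleton (BC3) for crux `LocalisationGHS` — item stmt-CriticalPhenomena-15882

Route `LocalisationClock` (route-CriticalPhenomena-LocalisationClock), crux rank 2, concluded BY NAME:
`Summit.CriticalPhenomena.Ising3DConformalLimit.Theses.LocalisationClock.LocalisationGHS` (SL-GHS, block form
with partial observation: for every finite ferromagnet `c ≥ 0`, observed block `e`, SNR `s ≥ 0`, with the planted
Gaussian channel `y = sσ* + √s Z` on `e`, posterior mean `m(y)` of the block spin and clock rate
`r(y) = Σ_{a∈e} Cov_y(σ_a, M_e)²`, the planted law `P` satisfies `P[r·m²] ≤ P[r]·P[m²]`; signature fixed by the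
route, never restated here).

## The line: LAW OF TOTAL COVARIANCE OVER THE PLANTED SIGNAL ("two-replica split")

`P[Φ] = ⟨ E_Z Φ(sσ* + √s Z) ⟩_{σ* ~ Gibbs(c)}`, so with `N(σ*) := E_Z[r m²] − E_Z[r]·E_Z[m²]` (conditional
covariance given the signal) and `B(σ*) := E_Z[r]`, `C(σ*) := E_Z[m²]`:

    P[r m²] − P[r]P[m²]  =  ⟨N⟩_Gibbs  +  Cov_Gibbs(B, C).

Two named stubs, one per term, each a covariance inequality for a SIMPLER randomness than the planted law:

* `stub_noiseGHS` (N-side, size L, the load-bearing stub): `⟨gibbsAvg⟩_σ* ∫ r m² dγ_σ* ≤ ⟨gibbsAvg⟩_σ* (∫ r dγ_σ*)(∫ m² dγ_σ*)`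
  — ON AVERAGE over the planted signal, the clock rate and the squared polarisation of ONE noisy observation are
  less correlated than those of two conditionally independent observations of the same signal. Pure Gaussian-noise
  statement given σ*; engine foreseen: Gaussian covariance interpolation `Cov_γ(F,G) = s∫₀¹E⟨∇F(X),∇G(X_α)⟩dα` with
  `∇_a m² = 2 m·Af_a`, `∇_a r = 2Σ_b Af_b·u₃^y(σ_a,σ_b,M_e)`, and a planted-averaged (Nishimori) GHS sign for the
  third cumulant `u₃^y` along the signal direction. Checks: small s — N = 2s²·Gᵀ K G + O(s³) ≤ 0 with
  `K_bc = u₄(⟨G,σ⟩, M_e, σ_b, σ_c) ≤ 0` (Lebowitz), i.e. N carries the whole Lebowitz coefficient of the crux;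
  s → ∞ (full observation), Laplace analysis of the one-coordinate excursions `y_a = O(1)`:
  `E_Z[r|σ*] ≈ κ_s Σ_a e^{−σ*_a h_a(σ*)}·π/2` and N ∝ −(3π/8)Σ_a ⟨e^{−σ_a h_a}⟩₀ < 0, because under the weight
  `e^{H − σ_a h_a}` the spin σ_a DECOUPLES (all bonds at a removed) so `⟨e^{−σ_a h_a} σ_a σ_b⟩₀ = 0`;
  c = 0 — N = full covariance = n·Cov(sech⁴y, tanh²y) ≤ 0, y ~ N(s,s) (Chebyshev). WARNING recorded for provers:
  the POINTWISE-in-σ* conditional covariance is FALSE (c = 0, balanced block M_e(σ*) = 0, s ≥ 1: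
  N(σ*) = n(κ₂ + 2|κ₁| t̄) > 0, registrar's c0_pointwise.py), so the σ*-average is essential — as typed.
* `stub_signalGKS` (S-side, size M–L): `gibbsAvg((∫ r)(∫ m²)) ≤ gibbsAvg(∫ r)·gibbsAvg(∫ m²)` — under the
  zero-field Gibbs law the noise-averaged rate `B(σ*)` and the noise-averaged squared polarisation `C(σ*)` are
  negatively correlated (ordered signals are stiff-free and polarised, disordered ones soft and unpolarised).
  Engine foreseen: GKS II. Checks: small s — `B = A(s) + s²·σ*ᵀKσ* + O(s³)`, `C = A'(s) + s²(G·σ*)² + O(s³)`,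
  so `Cov₀(B,C) = s⁴ Σ K_bc G_b' G_c' Cov₀(σ_bσ_c, σ_b'σ_c') + O(s⁵) ≤ 0` (K ≤ 0 Lebowitz, G ≥ 0 GKS I,
  Cov₀ ≥ 0 GKS II); s → ∞ (full observation) — `Cov₀(e^{−σ_a h_a}, M²) = ⟨e^{−σ_a h_a}⟩₀ (E_{G−a}[M²] + …
  − E_G[M²]) ≤ 0` by GKS II monotonicity in the couplings (same decoupling); c = 0 or |e| = 1 — S = 0 exactly.
* `LocalisationGHS_of : N → S → LocalisationGHS` — the join is `le_trans` (kernel-checked, sorry-free; the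
  let-telescope of the crux is reproduced verbatim, plus `ch` = channel and `γ` = noise law, and matches the
  crux's `P` by ζβ-reduction).

Numerical certificate of the SPLIT (not only of the crux): registrar's kit jobs j022732 (43 systems n ≤ 4, full and
partial observation, 14 SNRs; GH-20/14 quadrature: all large-SNR sign flags traced to under-resolved width-1/√s
excursions), j022787 (refined GH-40/120 + Simpson-1601 for |e| ≤ 2, GH-40/90 for |e| = 3, GH-30/52 for |e| = 4,
s = 1…14) and the pure-Python Simpson cross-checks pair_check.py / small_d2_check.py: N < 0 and S ≤ 0 in every
resolved case, relative sizes −N/(P[r]P[m²]) ≈ 0.06–0.76, −S/(P[r]P[m²]) ≈ 0–0.46; N dominates at small SNR,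
S at large SNR. Tables: `Lines/birth.md`.

Why not the route header's SNR-regime split (SmallSNR → LargeSNR → MidSNR): its middle piece is the crux on an
interval with free endpoints, i.e. the crux again (costume); the two-replica split instead separates two
inequalities of different type (Gaussian-noise / zero-field-Gibbs), neither of which is the crux or the summit
(BC3 probes, 4/4 failed) and whose sum is exactly the crux.

Disproof / negatives: no `Disproof.lean` for this crux (`ledger crux ls stmt-CriticalPhenomena-15882`: no
workfiles before this one, 2026-08-17); `ledger negatives --problem CriticalPhenomena`: 11 refuted statements,
none in Ising3DConformalLimit, none about planted / posterior covariances, Gaussian channels or GKS/GHS-type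
inequalities — no stub is an instance of a refuted statement.
Skeleton registrar: planner-skel-stmt-CriticalPhenomena-15882-0 (2026-08-17).
-/

namespace Summit.CriticalPhenomena.Ising3DConformalLimit.Cruxes.LocalisationGHS.Birth

open MeasureTheory ProbabilityTheory
open Literature.Probability.LatticeModels
open Summit.CriticalPhenomena.Ising3DConformalLimit.Theses.LocalisationClock (LocalisationGHS)

/-! ## Registered stubs (two statements, each spelled out; `LocalisationGHS_of` takes exactly these) -/

/-- **N — noise side (signal-averaged conditional covariance; size L, load-bearing).** For every finite
ferromagnet `c ≥ 0`, block `e`, SNR `s ≥ 0`, with the crux's `tilt, blk, m, Af, r`, the channel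
`ch σ z = (s σ_a + √s z_a) 𝟙_{a∈e}` and the noise law `γ = ⊗ N(0,1)`:
`⟨ ∫ r(ch σ z) m(ch σ z)² dγ ⟩_σ ≤ ⟨ (∫ r(ch σ z) dγ)(∫ m(ch σ z)² dγ) ⟩_σ` (Gibbs average over the planted σ).
One observation vs two conditionally independent observations of the same signal. NOT true pointwise in σ
(c = 0, balanced block, s ≥ 1); the average is essential. Small s: the Lebowitz coefficient 2s²GᵀKG ≤ 0;
s → ∞: −(3π/8)Σ_a⟨e^{−σ_a h_a}⟩₀ < 0. [Lebowitz1974; arXiv:2109.00709 (planted channel); arXiv:2107.09243] -/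
theorem stub_noiseGHS :
    ∀ (n : ℕ) (c : Fin n → Fin n → ℝ) (e : Fin n → Bool) (s : ℝ), (∀ a b, 0 ≤ c a b) → 0 ≤ s →
      let tilt : (Fin n → ℝ) → (SpinConfig (Fin n) → ℝ) → ℝ := fun y g =>
        PairIsing.gibbsAvg c (fun σ => g σ * Real.exp (∑ a, y a * spinAt a σ)) /
          PairIsing.gibbsAvg c (fun σ => Real.exp (∑ a, y a * spinAt a σ))
      let blk : SpinConfig (Fin n) → ℝ := fun σ => ∑ a, if e a then spinAt a σ else 0
      let m : (Fin n → ℝ) → ℝ := fun y => tilt y blk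
      let Af : (Fin n → ℝ) → Fin n → ℝ := fun y a =>
        tilt y (fun σ => spinAt a σ * blk σ) - tilt y (spinAt a) * m y
      let r : (Fin n → ℝ) → ℝ := fun y => ∑ a, if e a then Af y a ^ 2 else 0
      let ch : SpinConfig (Fin n) → (Fin n → ℝ) → (Fin n → ℝ) := fun σ z a =>
        if e a then s * spinAt a σ + Real.sqrt s * z a else 0
      let γ : Measure (Fin n → ℝ) := Measure.pi fun _ : Fin n => gaussianReal 0 1
      PairIsing.gibbsAvg c (fun σ => ∫ z, r (ch σ z) * m (ch σ z) ^ 2 ∂γ) ≤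
        PairIsing.gibbsAvg c (fun σ => (∫ z, r (ch σ z) ∂γ) * (∫ z, m (ch σ z) ^ 2 ∂γ)) := by
  sorry

/-- **S — signal side (zero-field Gibbs covariance of the noise-averaged functionals; size M–L).** With the same
data, `B(σ) := ∫ r(ch σ z) dγ` (noise-averaged clock rate given the planted configuration σ) and
`C(σ) := ∫ m(ch σ z)² dγ` (noise-averaged squared polarisation) satisfy `⟨B·C⟩_σ ≤ ⟨B⟩_σ ⟨C⟩_σ` under the
zero-field ferromagnetic Gibbs law `gibbsAvg c`. Small s: s⁴·ΣK_bc G_b' G_c' Cov₀(σ_bσ_c, σ_b'σ_c') ≤ 0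
(Lebowitz × GKS I × GKS II); s → ∞ (full observation): Cov₀(e^{−σ_a h_a}, M²) ≤ 0 by GKS II; ≡ 0 for c = 0 or
|e| = 1. [Griffiths/GKS II: Literature.Probability.LatticeModels (gksExpect); Lebowitz1974] -/
theorem stub_signalGKS :
    ∀ (n : ℕ) (c : Fin n → Fin n → ℝ) (e : Fin n → Bool) (s : ℝ), (∀ a b, 0 ≤ c a b) → 0 ≤ s →
      let tilt : (Fin n → ℝ) → (SpinConfig (Fin n) → ℝ) → ℝ := fun y g =>
        PairIsing.gibbsAvg c (fun σ => g σ * Real.exp (∑ a, y a * spinAt a σ)) /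
          PairIsing.gibbsAvg c (fun σ => Real.exp (∑ a, y a * spinAt a σ))
      let blk : SpinConfig (Fin n) → ℝ := fun σ => ∑ a, if e a then spinAt a σ else 0
      let m : (Fin n → ℝ) → ℝ := fun y => tilt y blk
      let Af : (Fin n → ℝ) → Fin n → ℝ := fun y a =>
        tilt y (fun σ => spinAt a σ * blk σ) - tilt y (spinAt a) * m y
      let r : (Fin n → ℝ) → ℝ := fun y => ∑ a, if e a then Af y a ^ 2 else 0
      let ch : SpinConfig (Fin n) → (Fin n → ℝ) → (Fin n → ℝ) := fun σ z a =>
        if e a then s * spinAt a σ + Real.sqrt s * z a else 0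
      let γ : Measure (Fin n → ℝ) := Measure.pi fun _ : Fin n => gaussianReal 0 1
      PairIsing.gibbsAvg c (fun σ => (∫ z, r (ch σ z) ∂γ) * (∫ z, m (ch σ z) ^ 2 ∂γ)) ≤
        PairIsing.gibbsAvg c (fun σ => ∫ z, r (ch σ z) ∂γ) *
          PairIsing.gibbsAvg c (fun σ => ∫ z, m (ch σ z) ^ 2 ∂γ) := by
  sorry

/-! ## Composition (sorry-free): the two stub STATEMENTS imply the crux, by name -/

/-- **COMPOSITION.** N → S → `LocalisationGHS` (the LocalisationClock decl of item stmt-CriticalPhenomena-15882).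
Law of total covariance over the planted signal: the crux's `P (r·m²)` is N's left side and `P r * P (m²)` is S's
right side (ζβ-definitionally), and N's right side is S's left side; one `le_trans`. -/
theorem LocalisationGHS_of :
    (∀ (n : ℕ) (c : Fin n → Fin n → ℝ) (e : Fin n → Bool) (s : ℝ), (∀ a b, 0 ≤ c a b) → 0 ≤ s →
      let tilt : (Fin n → ℝ) → (SpinConfig (Fin n) → ℝ) → ℝ := fun y g =>
        PairIsing.gibbsAvg c (fun σ => g σ * Real.exp (∑ a, y a * spinAt a σ)) /
          PairIsing.gibbsAvg c (fun σ => Real.exp (∑ a, y a * spinAt a σ))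
      let blk : SpinConfig (Fin n) → ℝ := fun σ => ∑ a, if e a then spinAt a σ else 0
      let m : (Fin n → ℝ) → ℝ := fun y => tilt y blk
      let Af : (Fin n → ℝ) → Fin n → ℝ := fun y a =>
        tilt y (fun σ => spinAt a σ * blk σ) - tilt y (spinAt a) * m y
      let r : (Fin n → ℝ) → ℝ := fun y => ∑ a, if e a then Af y a ^ 2 else 0
      let ch : SpinConfig (Fin n) → (Fin n → ℝ) → (Fin n → ℝ) := fun σ z a =>
        if e a then s * spinAt a σ + Real.sqrt s * z a else 0
      let γ : Measure (Fin n → ℝ) := Measure.pi fun _ : Fin n => gaussianReal 0 1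
      PairIsing.gibbsAvg c (fun σ => ∫ z, r (ch σ z) * m (ch σ z) ^ 2 ∂γ) ≤
        PairIsing.gibbsAvg c (fun σ => (∫ z, r (ch σ z) ∂γ) * (∫ z, m (ch σ z) ^ 2 ∂γ))) →
    (∀ (n : ℕ) (c : Fin n → Fin n → ℝ) (e : Fin n → Bool) (s : ℝ), (∀ a b, 0 ≤ c a b) → 0 ≤ s →
      let tilt : (Fin n → ℝ) → (SpinConfig (Fin n) → ℝ) → ℝ := fun y g =>
        PairIsing.gibbsAvg c (fun σ => g σ * Real.exp (∑ a, y a * spinAt a σ)) /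
          PairIsing.gibbsAvg c (fun σ => Real.exp (∑ a, y a * spinAt a σ))
      let blk : SpinConfig (Fin n) → ℝ := fun σ => ∑ a, if e a then spinAt a σ else 0
      let m : (Fin n → ℝ) → ℝ := fun y => tilt y blk
      let Af : (Fin n → ℝ) → Fin n → ℝ := fun y a =>
        tilt y (fun σ => spinAt a σ * blk σ) - tilt y (spinAt a) * m y
      let r : (Fin n → ℝ) → ℝ := fun y => ∑ a, if e a then Af y a ^ 2 else 0
      let ch : SpinConfig (Fin n) → (Fin n → ℝ) → (Fin n → ℝ) := fun σ z a =>
        if e a then s * spinAt a σ + Real.sqrt s * z a else 0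
      let γ : Measure (Fin n → ℝ) := Measure.pi fun _ : Fin n => gaussianReal 0 1
      PairIsing.gibbsAvg c (fun σ => (∫ z, r (ch σ z) ∂γ) * (∫ z, m (ch σ z) ^ 2 ∂γ)) ≤
        PairIsing.gibbsAvg c (fun σ => ∫ z, r (ch σ z) ∂γ) *
          PairIsing.gibbsAvg c (fun σ => ∫ z, m (ch σ z) ^ 2 ∂γ)) →
    LocalisationGHS := by
  intro hN hS n c e s hc hs
  exact le_trans (hN n c e s hc hs) (hS n c e s hc hs)

/-- The crux from the two registered stubs (shows the stubs have exactly the hypothesis types of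
`LocalisationGHS_of`; its only `sorry`s are the stubs'). -/
theorem LocalisationGHS_of_stubs : LocalisationGHS :=
  LocalisationGHS_of stub_noiseGHS stub_signalGKS

end Summit.CriticalPhenomena.Ising3DConformalLimit.Cruxes.LocalisationGHS.Birth
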